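import Summits.ResolutionOfSingularities.ResolutionOfSingularities.Theorems.WeightedInvariantLocalWeightedDropNCEndgameOrderOne
import Summits.ResolutionOfSingularities.ResolutionOfSingularities.Theorems.WeightedInvariantLocalWeightedDropNCGameRankMoves

/-!
# W4.3 `LocalWeightedDrop` — THE GRAPH LIFT ONE DIMENSION UP WITH ORDINAL WINS (every dimension): from a transfinitely won
# `(m+1)`-variable product `η · h` to the `(M+1)`-variable graph position `x_R ^ a · η^L · (x_R + h^L)`, `M = m + 1`

Crux item stmt-ResolutionOfSingularities-8899 `WeightedInvariant.LocalWeightedDrop` (route `ResolutionOfSingularities/WeightedInvariant`), ENGINE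
skeleton v32 (ddb48572591139d5), residuals `stub_wildWideApexFourStartsWon` (W4|₄) and `stub_spaceNCRankDrop`; strategist line `directrix-cut`
(res-L1-w43-strat-1 g7, `L/res-L1-w43-strat-1/g7/DIRECTRIX-CUT.md`, sub-skeleton `endord3_split.lean`), stub E = the ORDINAL endgame one dimension
up, port target E1 `stub_graphRelOrdThree` — here for EVERY `m` at once.  [OURS · L1 W4.3 · seat res-D-pv-006; def-free; R8's Phase 1
(`NCTransport.winsIn_graphRel`, res-L1-w43-strat-1's text, `…NCEndgameOrderOne`) re-run with `WinsOrd` for `WinsIn` and generic blocks; NOT a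
statement of any manuscript; AI-produced, gate-checked, weaker than expert review.]

THE THEOREM `winsOrd_graphRel (hM : m + rz + 1 = M)`: if `η, h ≠ 0` are `(m+1)`-variable germs whose product `η · h` is transfinitely won by
the `(m+1)`-variable mover with value `β` (`WinsOrd GermIsNC β (η * h)`), then the `(M+1)`-variable mover wins the graph position
`x_R ^ a · relBinom hM 1 η 1 h = x_R ^ a · η^L · (x_R + h^L)` with value `ω + β`.  PROOF = R8's Phase 1 by well-founded induction on `β`
instead of the round count: the value `ω + β` is strictly monotone in `β` and exceeds every finite Phase-2 budget, so no supremum over the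
answers and no order potential ((O) `orderGrowth`) is needed.  NON-TERMINAL STEP (`winsOrd_move`): the `(m+1)`-variable move of
`WinsOrd.exists_move` lifted with weight `0` on `x_R` (`isCountMove_blockExtend`, `subst_chart_blockExtend_relBinom`, `not_X_dvd_liftBracket`,
`X_mul_slice_liftTransform`, `saturation_unit_mul` — all block-generic, res-D-pv-036 / res-L1-w43-strat-1's R7 Phase A); the new position at the
live left slot is again a graph position whose `(m+1)`-variable product divides a power of the clause's successor (`winsOrd_of_dvd_pow`), of value
`β' < β`.  TERMINAL STEP (`exists_winsIn_graphRel_of_germIsNC`, the budget-free form of res-D-pv-006's 12:23:09Z shortcut): when `η · h` is a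
normal crossing, common legal coordinates make `η, h` unit monomials (`TrackC.exists_eq_unit_mul_monomial_of_dvd`), and the block-extended
coordinates turn the position into the UNIT BINOMIAL `vE^L · x^(ε ; a+1) + (vE vh)^L · x^(ε+e ; a)` whose exponents differ at the letter `x_R`
(`a + 1 ≠ a` in every field) — ONE application of `winsIn_binomial (toricStep M) (toricEnd M)` (R6/R7), then `winsOrd_of_winsIn`.
COROLLARY `exists_winsOrd_graphRel` (the `∃`-form) and its instance `graphRelOrdThree` at `(m, M) = (2, 3)` = the statement of strat-1's
`stub_graphRelOrdThree` VERBATIM (`h203 : 2 + rz + 1 = 3`).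
-/

noncomputable section

open Literature.AlgebraicGeometry.Resolution

set_option linter.dupNamespace false -- mandated namespace of this single-conjunct summit

namespace Summit.ResolutionOfSingularities.ResolutionOfSingularities.Theorems

namespace NCTransport

open MvPowerSeries TameFourTupleDrop

variable {k : Type} [Field k]

section Lift

variable {m M : ℕ} (hM : m + rz + 1 = M)

/-- The graph bracket, generic blocks: `relBinom hM 1 η 1 h = η^L · (x_R + h^L)`. -/
theorem relBinom_one_eta_one' (η h : MvPowerSeries (Fin (m + 1)) k) :
    relBinom hM 1 η 1 h = rename (bL hM) η * (X (bR hM 0) + rename (bL hM) h) := by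
  unfold relBinom
  simp only [map_one, one_mul, pow_one]

/-- **THE TERMINAL STEP (Phase 2 in one move-free line).**  If the `(m+1)`-variable product `η · h` is a normal crossing, the graph position
`x_R ^ a · η^L · (x_R + h^L)` is won within finitely many rounds: in the block extension of common monomialising coordinates it is a unit binomial
with a separating letter `x_R`, won by the toric game (`winsIn_binomial`, `toricStep`, `toricEnd`). -/
theorem exists_winsIn_graphRel_of_germIsNC (a : ℕ) {η h : MvPowerSeries (Fin (m + 1)) k} (hnc : GermIsNC (η * h)) :
    ∃ n, WinsIn (m := M) GermIsNC n (X (bR hM 0) ^ a * relBinom hM 1 η 1 h) := by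
  classical
  obtain ⟨Φ, u, γ, hΦ0, hdet, hu, hprod⟩ := hnc
  have hΦs : HasSubst Φ := hasSubst_of_constantCoeff_zero hΦ0
  have hsubst : subst Φ (η * h) = subst Φ η * subst Φ h := by rw [← coe_substAlgHom hΦs, map_mul]
  rw [hsubst] at hprod
  obtain ⟨vE, ε, hvE, hEeq⟩ := TrackC.exists_eq_unit_mul_monomial_of_dvd u hu γ (subst Φ η) ⟨subst Φ h, by rw [← hprod]⟩
  obtain ⟨vh, e, hvh, hheq⟩ := TrackC.exists_eq_unit_mul_monomial_of_dvd u hu γ (subst Φ h)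
    ⟨subst Φ η, by rw [← hprod, mul_comm]⟩
  -- the two exponents of the binomial
  obtain ⟨α, hα⟩ : ∃ α : Fin (M + 1) →₀ ℕ, α = Finsupp.equivFunOnFinite.symm (blockFun hM ε (fun _ => a + 1)) := ⟨_, rfl⟩
  obtain ⟨β, hβ⟩ : ∃ β : Fin (M + 1) →₀ ℕ, β = Finsupp.equivFunOnFinite.symm (blockFun hM (fun i => ε i + e i) (fun _ => a)) :=
    ⟨_, rfl⟩
  have hαp : (monomial α (1 : k) : MvPowerSeries (Fin (M + 1)) k) = (∏ i, X (bL hM i) ^ ε i) * X (bR hM 0) ^ (a + 1) := by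
    rw [hα, ← MonomialWon.prod_X_pow_eq_monomial, prod_block hM, prod_rz]
    simp only [blockFun_bL, blockFun_bR]
  have hβp : (monomial β (1 : k) : MvPowerSeries (Fin (M + 1)) k) =
      (∏ i, X (bL hM i) ^ ε i) * (∏ i, X (bL hM i) ^ e i) * X (bR hM 0) ^ a := by
    rw [hβ, ← MonomialWon.prod_X_pow_eq_monomial, prod_block hM, prod_rz]
    simp only [blockFun_bL, blockFun_bR, pow_add, Finset.prod_mul_distrib]
  -- the transported position: the rider `x_R ^ a` passes, the bracket data are monomialised
  have hbs : HasSubst (blockSubst hM Φ X) :=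
    hasSubst_of_constantCoeff_zero (constantCoeff_blockSubst hM hΦ0 fun j => constantCoeff_X j)
  have hx : (X (bR hM 0) : MvPowerSeries (Fin (M + 1)) k) ^ a = rename (bR hM) (X 0 ^ a) := by rw [map_pow, rename_X]
  have hrid : subst (blockSubst hM Φ X) ((X (bR hM 0) : MvPowerSeries (Fin (M + 1)) k) ^ a) = X (bR hM 0) ^ a := by
    rw [hx, subst_blockSubst_rename_bR hM hΦ0 (fun j => constantCoeff_X j) (X 0 ^ a), subst_self, id_eq]
  have hQ : subst (blockSubst hM Φ X) (X (bR hM 0) ^ a * relBinom hM 1 η 1 h) =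
      rename (bL hM) vE * monomial α 1 + (rename (bL hM) vE * rename (bL hM) vh) * monomial β 1 := by
    rw [← coe_substAlgHom hbs, map_mul, coe_substAlgHom hbs, hrid, subst_blockExtend_relBinom hM hΦ0 1 η 1 h, hEeq, hheq,
      ← coe_substAlgHom hΦs, map_one, relBinom_one_eta_one', hαp, hβp, map_mul, map_mul, map_prod, map_prod]
    simp only [map_pow, rename_X]
    ring
  have hv₁ : constantCoeff (rename (bL hM) vE) ≠ 0 := by rw [constantCoeff_rename]; exact hvE
  have hv₂ : constantCoeff (rename (bL hM) vE * rename (bL hM) vh) ≠ 0 := by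
    rw [map_mul, constantCoeff_rename, constantCoeff_rename]; exact mul_ne_zero hvE hvh
  have hsep : ∃ t, ((α t : ℕ) : k) ≠ ((β t : ℕ) : k) := ⟨bR hM 0, by
    rw [hα, hβ, Finsupp.coe_equivFunOnFinite_symm, Finsupp.coe_equivFunOnFinite_symm, blockFun_bR, blockFun_bR, Nat.cast_succ]
    intro h1
    have h2 : (a : k) + 1 = (a : k) + 0 := by rw [add_zero]; exact h1
    exact one_ne_zero (add_left_cancel h2)⟩
  have hbox : ∀ t, α t ≤ a + 1 + ∑ i, ε i + ∑ i, e i ∧ β t ≤ a + 1 + ∑ i, ε i + ∑ i, e i := by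
    intro t
    rw [hα, hβ, Finsupp.coe_equivFunOnFinite_symm, Finsupp.coe_equivFunOnFinite_symm]
    rcases block_cases hM t with ⟨i, rfl⟩ | ⟨j, rfl⟩
    · rw [blockFun_bL, blockFun_bL]
      have h1 : ε i ≤ ∑ i, ε i := Finset.single_le_sum (fun _ _ => Nat.zero_le _) (Finset.mem_univ i)
      have h3 : e i ≤ ∑ i, e i := Finset.single_le_sum (fun _ _ => Nat.zero_le _) (Finset.mem_univ i)
      constructor <;> omega
    · rw [blockFun_bR, blockFun_bR]
      constructor <;> omega
  have hwinQ := winsIn_binomial (toricStep M) (toricEnd M) hv₁ hv₂ hsep hbox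
  rw [← hQ] at hwinQ
  exact ⟨_, winsIn_germIsNC_of_subst (constantCoeff_blockSubst hM hΦ0 fun j => constantCoeff_X j)
    (by rw [det_linMat_blockSubst]; exact hdet.mul (isUnit_det_linMat_perm (Equiv.refl _))) _ _ hwinQ⟩

/-- **THE GRAPH LIFT WITH ORDINAL WINS (every `m`).**  From the graph position `x_R ^ a · η^L · (x_R + h^L)` (`η, h ≠ 0` germs in `m + 1`
variables) whose product `η · h` is transfinitely won with value `β` by the `(m+1)`-variable mover, the `(M+1)`-variable mover (`M = m + 1`) wins
transfinitely with value `ω + β`: it plays the `(m+1)`-variable moves lifted with weight `0` on `x_R` (R7 Phase A with `d = 1`, `M = 1`) while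
`η · h` is not a normal crossing, and the terminal step `exists_winsIn_graphRel_of_germIsNC` when it is. -/
theorem winsOrd_graphRel : ∀ (β : Ordinal.{0}) (a : ℕ) (η h : MvPowerSeries (Fin (m + 1)) k), η ≠ 0 → h ≠ 0 →
    WinsOrd (m := m) GermIsNC β (η * h) →
      WinsOrd (m := M) GermIsNC (Ordinal.omega0 + β) (X (bR hM 0) ^ a * relBinom hM 1 η 1 h) := by
  classical
  intro β
  induction β using WellFoundedLT.induction with
  | ind β ih =>
    intro a η h hη hh hwin
    by_cases hnc : GermIsNC (η * h)
    · obtain ⟨n, hn⟩ := exists_winsIn_graphRel_of_germIsNC hM a hnc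
      exact (winsOrd_of_winsIn hn).mono ((Ordinal.natCast_lt_omega0 n).le.trans le_self_add)
    obtain ⟨Φ₁, w₁, hmv, hcl⟩ := hwin.exists_move hnc
    refine winsOrd_move (isCountMove_blockExtend hM hmv) fun c hc hc0 A G hfac hG => ?_
    obtain ⟨hΦ0, hdet, hw1, -⟩ := hmv
    have hprz := MvPowerSeries.prime_X' k (0 : Fin (rz + 1))
    have hprime0 := MvPowerSeries.prime_X' k (0 : Fin (m + 1))
    have hprime := MvPowerSeries.prime_X' k (0 : Fin (m + 1 + 1))
    have hPrime := MvPowerSeries.prime_X' k (0 : Fin (M + 1 + 1))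
    -- the exceptional point restricted to the left block
    have hcR : ∀ j, c (bR hM j) = 0 := fun j => hc _ (by rw [blockFun_bR]; rfl)
    have hc₁ : ∀ i, w₁ i = 0 → c (bL hM i) = 0 := fun i hi => hc _ (by rw [blockFun_bL]; exact hi)
    have hc₁0 : (fun i => c (bL hM i)) ≠ 0 := by
      intro h0
      apply hc0
      funext l
      rcases block_cases hM l with ⟨i, rfl⟩ | ⟨j, rfl⟩
      · exact congr_fun h0 i
      · exact hcR j
    -- the two left transforms and their `s`-saturations; the transform of `1`
    have hne : ∀ {F : MvPowerSeries (Fin (m + 1)) k}, F ≠ 0 →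
        subst (CobordantChart.chart w₁ fun i => c (bL hM i)) (subst Φ₁ F) ≠ 0 := fun hF =>
      CobordantChart.subst_chart_ne_zero w₁ _ hc₁ (FormalCoordChange.subst_ne_zero_of_isUnit_det hΦ0 hdet hF)
    obtain ⟨aE, GE, hfacE, hGE⟩ := CobordantVertexChart.exists_eq_X_pow_mul_not_dvd (hne hη)
    obtain ⟨ah, Gh, hfach, hGh⟩ := CobordantVertexChart.exists_eq_X_pow_mul_not_dvd (hne hh)
    have hch₁ := CobordantChart.hasSubst_chart w₁ (fun i => c (bL hM i)) hc₁
    have hΦ₁s : HasSubst Φ₁ := hasSubst_of_constantCoeff_zero hΦ0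
    have hfac1 : subst (CobordantChart.chart w₁ fun i => c (bL hM i)) (subst Φ₁ (1 : MvPowerSeries (Fin (m + 1)) k)) =
        X 0 ^ 0 * 1 := by
      rw [← coe_substAlgHom hΦ₁s, map_one, ← coe_substAlgHom hch₁, map_one, pow_zero, one_mul]
    have hG1 : ¬ X 0 ∣ (1 : MvPowerSeries (Fin (m + 1 + 1)) k) := hprime.not_dvd_one
    -- the product transform
    have hfac₁ : subst (CobordantChart.chart w₁ fun i => c (bL hM i)) (subst Φ₁ (η * h)) = X 0 ^ (aE + ah) * (GE * Gh) := by
      rw [← coe_substAlgHom hΦ₁s, map_mul, coe_substAlgHom hΦ₁s, ← coe_substAlgHom hch₁, map_mul, coe_substAlgHom hch₁, hfacE,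
        hfach]
      ring
    have hG₁ : ¬ X 0 ∣ GE * Gh := fun h' => (hprime.dvd_or_dvd h').elim hGE hGh
    -- the rider `x_R ^ a` passes through unchanged
    have hbs : HasSubst (blockSubst hM Φ₁ X) :=
      hasSubst_of_constantCoeff_zero (constantCoeff_blockSubst hM hΦ0 fun j => constantCoeff_X j)
    have hch := CobordantChart.hasSubst_chart (blockFun hM w₁ 0) c hc
    have hx : (X (bR hM 0) : MvPowerSeries (Fin (M + 1)) k) ^ a = rename (bR hM) (X 0 ^ a) := by rw [map_pow, rename_X]
    have hridΦ : subst (blockSubst hM Φ₁ X) ((X (bR hM 0) : MvPowerSeries (Fin (M + 1)) k) ^ a) = rename (bR hM) (X 0 ^ a) := by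
      rw [hx, subst_blockSubst_rename_bR hM hΦ0 (fun j => constantCoeff_X j) (X 0 ^ a), subst_self, id_eq]
    have hridc : subst (CobordantChart.chart (blockFun hM w₁ 0) c) (rename (bR hM) ((X 0 : MvPowerSeries (Fin (rz + 1)) k) ^ a)) =
        rename (bR (succ_hM hM)) (X 0 ^ a) :=
      subst_chart_rename_bR hM hc (fun j => by rw [blockFun_bR]; rfl) (X 0 ^ a)
    -- the transform of the graph position: `s^aE · Big`
    have hprod : subst (CobordantChart.chart (blockFun hM w₁ 0) c) (subst (blockSubst hM Φ₁ X)
        (X (bR hM 0) ^ a * relBinom hM 1 η 1 h)) =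
        X 0 ^ aE * (rename (bR (succ_hM hM)) (X 0 ^ a) * (rename (bL (succ_hM hM)) GE *
          (X 0 ^ 0 * rename (bL (succ_hM hM)) 1 * X (bR (succ_hM hM) 0) ^ 1 + X 0 ^ ah * rename (bL (succ_hM hM)) Gh))) := by
      rw [← coe_substAlgHom hbs, map_mul, coe_substAlgHom hbs, hridΦ, ← coe_substAlgHom hch, map_mul, coe_substAlgHom hch, hridc,
        subst_chart_blockExtend_relBinom hM hΦ0 hc 1 η 1 h, hfacE, hfac1, hfach]
      simp only [map_mul, map_pow, rename_bL_X_zero hM]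
      ring
    have hGbig : ¬ X 0 ∣ rename (bR (succ_hM hM)) (X 0 ^ a) * (rename (bL (succ_hM hM)) GE *
        (X 0 ^ 0 * rename (bL (succ_hM hM)) 1 * X (bR (succ_hM hM) 0) ^ 1 + X 0 ^ ah * rename (bL (succ_hM hM)) Gh)) :=
      fun h' => (hPrime.dvd_or_dvd h').elim (fun h1 => pow_ne_zero a hprz.ne_zero (eq_zero_of_X_dvd_rename_bR hM h1))
        (fun h2 => (hPrime.dvd_or_dvd h2).elim (fun h3 => hGE (X_dvd_of_X_dvd_rename_bL hM h3))
          (not_X_dvd_liftBracket hM hG1 hGh (Or.inl rfl) one_ne_zero))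
    have hsat : (1 : MvPowerSeries (Fin (M + 1 + 1)) k) * (X 0 ^ aE * (rename (bR (succ_hM hM)) (X 0 ^ a) *
        (rename (bL (succ_hM hM)) GE * (X 0 ^ 0 * rename (bL (succ_hM hM)) 1 * X (bR (succ_hM hM) 0) ^ 1 +
          X 0 ^ ah * rename (bL (succ_hM hM)) Gh)))) = X 0 ^ A * G := by rw [one_mul, ← hprod, hfac]
    obtain ⟨-, hGeq⟩ := saturation_unit_mul (by rw [map_one]; exact one_ne_zero) hGbig hG hsat
    -- the clause of the `(m+1)`-variable move picks the live (left) slot and the value `β' < β`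
    obtain ⟨i₁, hci₁, β', hβ', hwin₁⟩ := hcl (fun i => c (bL hM i)) hc₁ hc₁0 _ _ hfac₁ hG₁
    refine ⟨bL hM i₁, hci₁, Ordinal.omega0 + β', (add_lt_add_iff_left Ordinal.omega0).mpr hβ', ?_⟩
    have hnew : X 0 * TupleGame.slice (bL hM i₁) G =
        X (bR hM 0) ^ a * relBinom hM 1 (X 0 * TupleGame.slice i₁ GE) 1 (TupleGame.slice i₁ (X 0 ^ ah * Gh)) := by
      rw [hGeq, one_mul, slice_mul, slice_bL_rename_bR hM, mul_left_comm, X_mul_slice_liftTransform hM i₁ 0 ah 1, map_pow,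
        rename_X, pow_zero, one_mul, slice_one]
    rw [hnew]
    -- the successors are non-zero
    have hsE0 := TupleDropAssembly.slice_ne_zero (subst Φ₁ η) w₁ _ hc₁ hw1 aE GE hfacE hGE i₁ hci₁
    have hsh0 := TupleDropAssembly.slice_ne_zero (subst Φ₁ h) w₁ _ hc₁ hw1 _ Gh hfach hGh i₁ hci₁
    have hE' : X 0 * TupleGame.slice i₁ GE ≠ 0 := mul_ne_zero hprime0.ne_zero hsE0
    have hh' : TupleGame.slice i₁ (X 0 ^ ah * Gh) ≠ 0 := by
      rw [slice_mul, slice_pow, WildTerminal.slice_X_zero]; exact mul_ne_zero (pow_ne_zero _ hprime0.ne_zero) hsh0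
    -- the product of the successors is won with value `β'` (it divides a power of the clause's position)
    have hne₁ : X 0 * TupleGame.slice i₁ (GE * Gh) ≠ 0 :=
      mul_ne_zero hprime0.ne_zero (TupleDropAssembly.slice_ne_zero (subst Φ₁ (η * h)) w₁ _ hc₁ hw1 _ _ hfac₁ hG₁ i₁ hci₁)
    have hdvd : X 0 * TupleGame.slice i₁ GE * TupleGame.slice i₁ (X 0 ^ ah * Gh) ∣ (X 0 * TupleGame.slice i₁ (GE * Gh)) ^ (ah + 1) := by
      rw [slice_mul, slice_mul, slice_pow, WildTerminal.slice_X_zero]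
      exact ⟨(TupleGame.slice i₁ GE * TupleGame.slice i₁ Gh) ^ ah, by ring⟩
    have hwin' : WinsOrd GermIsNC β' (X 0 * TupleGame.slice i₁ GE * TupleGame.slice i₁ (X 0 ^ ah * Gh)) :=
      winsOrd_of_dvd_pow (fun N b' d' hd' hnc' hdvd' => germIsNC_of_dvd_pow N b' d' hd' hnc' hdvd') hne₁ hwin₁ hdvd
    exact ih β' hβ' a _ _ hE' hh' hwin'

/-- **THE GRAPH LIFT, `∃`-form** (the shape of strat-1's port target E1): a transfinitely won product `η · h` in `m + 1` variables makes every
graph position `x_R ^ a · η^L · (x_R + h^L)` in `M + 1 = m + 2` variables transfinitely won. -/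
theorem exists_winsOrd_graphRel (a : ℕ) (η h : MvPowerSeries (Fin (m + 1)) k) (hη : η ≠ 0) (hh : h ≠ 0)
    (hwin : ∃ β : Ordinal.{0}, WinsOrd (m := m) GermIsNC β (η * h)) :
    ∃ α : Ordinal.{0}, WinsOrd (m := M) GermIsNC α (X (bR hM 0) ^ a * relBinom hM 1 η 1 h) := by
  obtain ⟨β, hβ⟩ := hwin
  exact ⟨_, winsOrd_graphRel hM β a η h hη hh hβ⟩

end Lift

/-! ## The instance `(m, M) = (2, 3)`: strat-1's `stub_graphRelOrdThree` -/

/-- Block arithmetic for `k⟦x₀, x₁, x₂ | x₃⟧`. -/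
theorem h203 : 2 + rz + 1 = 3 := rfl

/-- **`stub_graphRelOrdThree` OF LINE `directrix-cut` (res-L1-w43-strat-1 g7, `endord3_split.lean`), its statement verbatim**: the graph lift from
the three-variable NC game to four variables with ordinal wins. -/
theorem graphRelOrdThree : ∀ (k : Type) [Field k] (a : ℕ) (η h : MvPowerSeries (Fin (2 + 1)) k), η ≠ 0 → h ≠ 0 →
    (∃ β : Ordinal.{0}, WinsOrd (m := 2) GermIsNC β (η * h)) →
      ∃ α : Ordinal.{0}, WinsOrd (m := 3) GermIsNC α (X (bR h203 0) ^ a * relBinom h203 1 η 1 h) :=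
  fun _ _ a η h hη hh hwin => exists_winsOrd_graphRel h203 a η h hη hh hwin

end NCTransport

end Summit.ResolutionOfSingularities.ResolutionOfSingularities.Theorems
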